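import Mathlib

/-!
# Imbrie (2016), the three-spin block: the resolvent of `e₁A₁ + e₃A₃` for commuting involutions

[cite: ImbrieJSP2016, eq. (1.1), assumption LLA(ν, C)]  Repair cell b2b-imbrie, LLA.md block Q
(gen 9), Lemma Q4(b).  In the sector decomposition of the three-spin block of
[ImbrieJSP2016, eq. (1.1)] (a-picture of bond (1,2), conventions of `FlatPair` / `DressedGapDensity`)
the sector-(−) Hamiltonian is `H₋ − ā₋ = e₁′A₁ + e₃′A₃` with COMMUTING INVOLUTIONS
`A₁ = (u′Z₁ + t₁X₁)/e₁′`, `A₃ = (v₋Z₃ + t₃X₃)/e₃′` (`A₁² = A₃² = 1`, `A₁A₃ = A₃A₁`).  Lemma Q4(b)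
states that every function of `H₋` — in particular the exact quartet perturbation
`R̃_j = t₂²(E_j − H₋)⁻¹` of the all-orders matching — lies in `span{1, A₁, A₃, A₁A₃}`:
`(z − e₁A₁ − e₃A₃)⁻¹ = Σ_{a,b = ±1} (1 + aA₁)(1 + bA₃) / (4(z − ae₁ − be₃)) = α + βA₁ + γA₃ + κA₁A₃`
with `(α, β, γ, κ) = ¼ Σ_{ab} (1, a, b, ab)/(z − ae₁ − be₃)`.  This file proves the identity in any
algebra over a field (two-sided inverse; explicit coefficients), which is the algebraic core of the
Corollary "the Ω-corner family is the rigid family `𝔥_κ`" (LLA.md Q4(b)).  Pure algebra; no analysis.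
-/

namespace Literature.MathematicalPhysics.QuantumLattice.Imbrie2016

namespace CommutingInvolutionResolvent

variable {𝕜 : Type*} [Field 𝕜] {R : Type*} [Ring R] [Algebra 𝕜 R]

/-- [cite: ImbrieJSP2016, eq. (1.1)] the spectral-projector product `(1 + aA₁)(1 + bA₃)` (four times
the projector onto the joint `(a,b)`-eigenspace when `a, b = ±1`). -/
def proj (A₁ A₃ : R) (a b : 𝕜) : R := (1 + a • A₁) * (1 + b • A₃)

/-- [cite: ImbrieJSP2016, eq. (1.1)] the candidate resolvent
`Σ_{a,b = ±1} (4(z − ae₁ − be₃))⁻¹ • (1 + aA₁)(1 + bA₃)`. -/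
def resolventFormula (A₁ A₃ : R) (z e₁ e₃ : 𝕜) : R :=
  (4 * (z - e₁ - e₃))⁻¹ • proj A₁ A₃ (1 : 𝕜) 1 + (4 * (z - e₁ + e₃))⁻¹ • proj A₁ A₃ (1 : 𝕜) (-1) +
  (4 * (z + e₁ - e₃))⁻¹ • proj A₁ A₃ (-1 : 𝕜) 1 + (4 * (z + e₁ + e₃))⁻¹ • proj A₁ A₃ (-1 : 𝕜) (-1)

/-- [cite: ImbrieJSP2016, eq. (1.1)] the operator `z − e₁A₁ − e₃A₃`. -/
def shifted (A₁ A₃ : R) (z e₁ e₃ : 𝕜) : R := algebraMap 𝕜 R z - e₁ • A₁ - e₃ • A₃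

section lemmas

variable {A₁ A₃ : R}

/-- [cite: ImbrieJSP2016, eq. (1.1)] `A₁ (1 + aA₁)(1 + bA₃) = a (1 + aA₁)(1 + bA₃)` for `a² = 1`. -/
theorem invol₁_mul_proj (h1 : A₁ * A₁ = 1) {a : 𝕜} (ha : a * a = 1) (b : 𝕜) :
    A₁ * proj A₁ A₃ a b = a • proj A₁ A₃ a b := by
  unfold proj
  have key : A₁ * (1 + a • A₁) = a • (1 + a • A₁) := by
    rw [mul_add, mul_one, mul_smul_comm, h1, smul_add, smul_smul, ha, one_smul, add_comm]
  rw [← mul_assoc, key, smul_mul_assoc]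

/-- [cite: ImbrieJSP2016, eq. (1.1)] `A₃ (1 + aA₁)(1 + bA₃) = b (1 + aA₁)(1 + bA₃)` for `b² = 1`,
using `A₁A₃ = A₃A₁`. -/
theorem invol₃_mul_proj (h3 : A₃ * A₃ = 1) (hc : A₁ * A₃ = A₃ * A₁) (a : 𝕜) {b : 𝕜}
    (hb : b * b = 1) : A₃ * proj A₁ A₃ a b = b • proj A₁ A₃ a b := by
  unfold proj
  have comm : A₃ * (1 + a • A₁) = (1 + a • A₁) * A₃ := by
    rw [mul_add, add_mul, mul_one, one_mul, mul_smul_comm, smul_mul_assoc, hc]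
  have key : A₃ * (1 + b • A₃) = b • (1 + b • A₃) := by
    rw [mul_add, mul_one, mul_smul_comm, h3, smul_add, smul_smul, hb, one_smul, add_comm]
  rw [← mul_assoc, comm, mul_assoc, key, mul_smul_comm]

/-- [cite: ImbrieJSP2016, eq. (1.1)] `(1 + aA₁)(1 + bA₃) A₁ = a (1 + aA₁)(1 + bA₃)` for `a² = 1`,
using `A₁A₃ = A₃A₁`. -/
theorem proj_mul_invol₁ (h1 : A₁ * A₁ = 1) (hc : A₁ * A₃ = A₃ * A₁) {a : 𝕜} (ha : a * a = 1)
    (b : 𝕜) : proj A₁ A₃ a b * A₁ = a • proj A₁ A₃ a b := by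
  unfold proj
  have comm : (1 + b • A₃) * A₁ = A₁ * (1 + b • A₃) := by
    rw [mul_add, add_mul, mul_one, one_mul, mul_smul_comm, smul_mul_assoc, hc]
  have key : (1 + a • A₁) * A₁ = a • (1 + a • A₁) := by
    rw [add_mul, one_mul, smul_mul_assoc, h1, smul_add, smul_smul, ha, one_smul, add_comm]
  rw [mul_assoc, comm, ← mul_assoc, key, smul_mul_assoc]

/-- [cite: ImbrieJSP2016, eq. (1.1)] `(1 + aA₁)(1 + bA₃) A₃ = b (1 + aA₁)(1 + bA₃)` for `b² = 1`. -/
theorem proj_mul_invol₃ (h3 : A₃ * A₃ = 1) (a : 𝕜) {b : 𝕜} (hb : b * b = 1) :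
    proj A₁ A₃ a b * A₃ = b • proj A₁ A₃ a b := by
  unfold proj
  have key : (1 + b • A₃) * A₃ = b • (1 + b • A₃) := by
    rw [add_mul, one_mul, smul_mul_assoc, h3, smul_add, smul_smul, hb, one_smul, add_comm]
  rw [mul_assoc, key, mul_smul_comm]

/-- [cite: ImbrieJSP2016, eq. (1.1)] `(z − e₁A₁ − e₃A₃)(1 + aA₁)(1 + bA₃) = (z − ae₁ − be₃)(1 + aA₁)(1 + bA₃)`. -/
theorem shifted_mul_proj (h1 : A₁ * A₁ = 1) (h3 : A₃ * A₃ = 1) (hc : A₁ * A₃ = A₃ * A₁)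
    (z e₁ e₃ : 𝕜) {a b : 𝕜} (ha : a * a = 1) (hb : b * b = 1) :
    shifted A₁ A₃ z e₁ e₃ * proj A₁ A₃ a b = (z - a * e₁ - b * e₃) • proj A₁ A₃ a b := by
  unfold shifted
  rw [sub_mul, sub_mul, Algebra.algebraMap_eq_smul_one, smul_mul_assoc, one_mul, smul_mul_assoc,
    smul_mul_assoc, invol₁_mul_proj h1 ha, invol₃_mul_proj h3 hc a hb, smul_smul, smul_smul,
    ← sub_smul, ← sub_smul, mul_comm e₁ a, mul_comm e₃ b]

/-- [cite: ImbrieJSP2016, eq. (1.1)] `(1 + aA₁)(1 + bA₃)(z − e₁A₁ − e₃A₃) = (z − ae₁ − be₃)(1 + aA₁)(1 + bA₃)`. -/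
theorem proj_mul_shifted (h1 : A₁ * A₁ = 1) (h3 : A₃ * A₃ = 1) (hc : A₁ * A₃ = A₃ * A₁)
    (z e₁ e₃ : 𝕜) {a b : 𝕜} (ha : a * a = 1) (hb : b * b = 1) :
    proj A₁ A₃ a b * shifted A₁ A₃ z e₁ e₃ = (z - a * e₁ - b * e₃) • proj A₁ A₃ a b := by
  unfold shifted
  rw [mul_sub, mul_sub, Algebra.algebraMap_eq_smul_one, mul_smul_comm, mul_one, mul_smul_comm,
    mul_smul_comm, proj_mul_invol₁ h1 hc ha, proj_mul_invol₃ h3 a hb, smul_smul, smul_smul,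
    ← sub_smul, ← sub_smul, mul_comm e₁ a, mul_comm e₃ b]

/-- [cite: ImbrieJSP2016, eq. (1.1)] the four projector products sum to `4`. -/
theorem proj_sum (A₁ A₃ : R) :
    proj A₁ A₃ (1 : 𝕜) 1 + proj A₁ A₃ (1 : 𝕜) (-1) + proj A₁ A₃ (-1 : 𝕜) 1 +
      proj A₁ A₃ (-1 : 𝕜) (-1) = 4 := by
  unfold proj
  simp only [one_smul, neg_smul, ← sub_eq_add_neg]
  have fac : (1 + A₁) * (1 + A₃) + (1 + A₁) * (1 - A₃) + (1 - A₁) * (1 + A₃) +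
      (1 - A₁) * (1 - A₃) = ((1 + A₁) + (1 - A₁)) * ((1 + A₃) + (1 - A₃)) := by
    noncomm_ring
  have two₁ : (1 + A₁) + (1 - A₁) = (2 : R) := by rw [add_add_sub_cancel, one_add_one_eq_two]
  have two₃ : (1 + A₃) + (1 - A₃) = (2 : R) := by rw [add_add_sub_cancel, one_add_one_eq_two]
  rw [fac, two₁, two₃]
  norm_num

end lemmas

/-- [cite: ImbrieJSP2016, eq. (1.1)] **Lemma Q4(b), resolvent form.**  For commuting involutions
`A₁, A₃` in an algebra over a field with `4 ≠ 0` (e.g. `ℝ`, `ℂ`) and scalars `z, e₁, e₃` with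
`z ≠ ±e₁ ± e₃`, the element
`Σ_{a,b=±1} (1 + aA₁)(1 + bA₃)/(4(z − ae₁ − be₃))` is a two-sided inverse of `z − e₁A₁ − e₃A₃`. -/
theorem resolventFormula_isInverse {A₁ A₃ : R} (h1 : A₁ * A₁ = 1) (h3 : A₃ * A₃ = 1)
    (hc : A₁ * A₃ = A₃ * A₁) (h4 : (4 : 𝕜) ≠ 0) {z e₁ e₃ : 𝕜} (hpp : z - e₁ - e₃ ≠ 0)
    (hpm : z - e₁ + e₃ ≠ 0) (hmp : z + e₁ - e₃ ≠ 0) (hmm : z + e₁ + e₃ ≠ 0) :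
    shifted A₁ A₃ z e₁ e₃ * resolventFormula A₁ A₃ z e₁ e₃ = 1 ∧
      resolventFormula A₁ A₃ z e₁ e₃ * shifted A₁ A₃ z e₁ e₃ = 1 := by
  have h1s : (1 : 𝕜) * 1 = 1 := one_mul 1
  have hns : (-1 : 𝕜) * -1 = 1 := by ring
  have e_pp : z - 1 * e₁ - 1 * e₃ = z - e₁ - e₃ := by ring
  have e_pm : z - 1 * e₁ - -1 * e₃ = z - e₁ + e₃ := by ring
  have e_mp : z - -1 * e₁ - 1 * e₃ = z + e₁ - e₃ := by ring
  have e_mm : z - -1 * e₁ - -1 * e₃ = z + e₁ + e₃ := by ring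
  have c_pp : (4 * (z - e₁ - e₃))⁻¹ * (z - e₁ - e₃) = 4⁻¹ := by field_simp
  have c_pm : (4 * (z - e₁ + e₃))⁻¹ * (z - e₁ + e₃) = 4⁻¹ := by field_simp
  have c_mp : (4 * (z + e₁ - e₃))⁻¹ * (z + e₁ - e₃) = 4⁻¹ := by field_simp
  have c_mm : (4 * (z + e₁ + e₃))⁻¹ * (z + e₁ + e₃) = 4⁻¹ := by field_simp
  have four : (4⁻¹ : 𝕜) • (proj A₁ A₃ (1 : 𝕜) 1 + proj A₁ A₃ (1 : 𝕜) (-1) + proj A₁ A₃ (-1 : 𝕜) 1 +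
      proj A₁ A₃ (-1 : 𝕜) (-1)) = (1 : R) := by
    rw [proj_sum]
    rw [show (4 : R) = algebraMap 𝕜 R 4 from (map_ofNat (algebraMap 𝕜 R) 4).symm,
      Algebra.algebraMap_eq_smul_one, smul_smul, inv_mul_cancel₀ h4, one_smul]
  constructor
  · unfold resolventFormula
    rw [mul_add, mul_add, mul_add, mul_smul_comm, mul_smul_comm, mul_smul_comm, mul_smul_comm,
      shifted_mul_proj h1 h3 hc z e₁ e₃ h1s h1s, shifted_mul_proj h1 h3 hc z e₁ e₃ h1s hns,
      shifted_mul_proj h1 h3 hc z e₁ e₃ hns h1s, shifted_mul_proj h1 h3 hc z e₁ e₃ hns hns,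
      e_pp, e_pm, e_mp, e_mm, smul_smul, smul_smul, smul_smul, smul_smul, c_pp, c_pm, c_mp, c_mm,
      ← smul_add, ← smul_add, ← smul_add, four]
  · unfold resolventFormula
    rw [add_mul, add_mul, add_mul, smul_mul_assoc, smul_mul_assoc, smul_mul_assoc, smul_mul_assoc,
      proj_mul_shifted h1 h3 hc z e₁ e₃ h1s h1s, proj_mul_shifted h1 h3 hc z e₁ e₃ h1s hns,
      proj_mul_shifted h1 h3 hc z e₁ e₃ hns h1s, proj_mul_shifted h1 h3 hc z e₁ e₃ hns hns,
      e_pp, e_pm, e_mp, e_mm, smul_smul, smul_smul, smul_smul, smul_smul, c_pp, c_pm, c_mp, c_mm,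
      ← smul_add, ← smul_add, ← smul_add, four]

/-- [cite: ImbrieJSP2016, eq. (1.1)] **Lemma Q4(b), span form.**  The resolvent formula expands as
`α•1 + β•A₁ + γ•A₃ + κ•(A₁A₃)` with `(α,β,γ,κ) = Σ_{ab} (1, a, b, ab)•c_{ab}`,
`c_{ab} = (4(z − ae₁ − be₃))⁻¹`: every such resolvent lies in `span{1, A₁, A₃, A₁A₃}`. -/
theorem resolventFormula_eq_span (A₁ A₃ : R) (z e₁ e₃ : 𝕜) :
    resolventFormula A₁ A₃ z e₁ e₃ =
      ((4 * (z - e₁ - e₃))⁻¹ + (4 * (z - e₁ + e₃))⁻¹ + (4 * (z + e₁ - e₃))⁻¹ +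
          (4 * (z + e₁ + e₃))⁻¹) • (1 : R) +
      ((4 * (z - e₁ - e₃))⁻¹ + (4 * (z - e₁ + e₃))⁻¹ - (4 * (z + e₁ - e₃))⁻¹ -
          (4 * (z + e₁ + e₃))⁻¹) • A₁ +
      ((4 * (z - e₁ - e₃))⁻¹ - (4 * (z - e₁ + e₃))⁻¹ + (4 * (z + e₁ - e₃))⁻¹ -
          (4 * (z + e₁ + e₃))⁻¹) • A₃ +
      ((4 * (z - e₁ - e₃))⁻¹ - (4 * (z - e₁ + e₃))⁻¹ - (4 * (z + e₁ - e₃))⁻¹ +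
          (4 * (z + e₁ + e₃))⁻¹) • (A₁ * A₃) := by
  unfold resolventFormula proj
  simp only [one_smul, neg_smul, mul_add, add_mul, mul_one, one_mul, mul_neg, neg_mul, smul_add,
    smul_neg]
  module

end CommutingInvolutionResolvent

end Literature.MathematicalPhysics.QuantumLattice.Imbrie2016
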